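import Summits.Ventures.PercRepro.ProfileUnicyclicCircuitBottom

/-!
# PercRepro — ERRATUM 3: THE BOTTOM-LEVEL CIRCUIT-MARKED CONJECTURE IS FALSE FOR CIRCUITS OF SIZE ≥ 3; THE EXCESS-BOUNDED FORM
(p10, gen 11; `proofs/P10-AVFULL.md` §19(k), `mining/p10/g11/`)

ERRATUM to `UniCircLymBottom` (ProfileUnicyclicCircuitBottom, p433429): the bottom-level statement
`ρ·U^D_{n−ρ} ≤ (n − ρ)·U^D_{n−ρ+1}` for every `D` with `2(n − ρ) + 1 ≤ n` is FALSE as soon as `#D ≥ 3`.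
WITNESS A (at the boundary `2(n − ρ) + 1 = n`): the graphic matroid of a triangle `u v w` plus six paths of length two
(two each between `u–v`, `v–w`, `w–u`); `n = 15`, `ρ = 8`, `D` = the triangle: `U^D_7 = U^D_8 = 192`, so
`8·192 = 1536 > 7·192 = 1344` (exhaustive enumeration of the `2^15` subsets in two implementations, mining/p10/g11/
w15.py and bf.c / allD.c; closed form for ear multiplicities `(a, b, c)`, `t = a + b + c`:
`U^D_{n−ρ} = (ab + bc + ca)·2^{t−2}`, `U^D_{n−ρ+1} = t·2^{t−1}`, violated iff `(t + 2)(ab + bc + ca) > 2t(t + 1)`).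
WITNESS B (strictly inside the hypothesis, `n = 2(n − ρ) + 2`): the `4`-cycle plus ten paths of length two
(two on each of its four pairs, one on each diagonal); `n = 24`, `ρ = 13`, `D` = the `4`-cycle:
`13·9216 = 119808 > 11·10496 = 115456`.  A `c`-cycle with such "ears" has excess `2ρ − n = c − 2`, and the needed
per-circuit coefficient grows like `t²` — the `c = 2` case is the `Θ_t` family at excess `0`.  With one coloop or one
longer ear (excess `≥ #D − 1`) every instance complies.  The SUM over circuits `(c)` holds on both witnesses
(`1536 ≤ 9408`; `119808 ≤ 1455872`), so the per-circuit reduction of `(c)` — `uniLym_c_of_uniCircLymBottom`, a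
theorem with a false hypothesis — is withdrawn; `(c)` is open again as a sum over circuits at `ρ = q + 2`.

* `UniCircLymBottomExcess` — the candidate repair (a `Prop`, NOT asserted): the same inequality under the extra
  hypothesis `#D + n ≤ 2ρ + 1` (the excess `2ρ − n` is at least `#D − 1`); for `#D ≤ 2` it is the old hypothesis,
  so the loop and parallel-pair instances (`uniCircLym_loop`, `markedLym_iff_uniCircLym_parallel`) are unchanged;
* `uniCircLymBottomExcess_of_uniCircLymBottom` — the refuted statement implies it (dependency graph only);
* **`uniLym_c_small_of_uniCircLymBottomExcess`** — what survives of the bridge to `(c)`: on `#E = ρ + q + 1`,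
  `q + 2 ≤ ρ`, the unicyclic counts restricted to the circuits of size `≤ ρ − q` satisfy `(c)`.  At the boundary
  `ρ = q + 2` only the loops and parallel pairs are covered.
-/

open scoped Matroid

namespace PercRepro.Cogirth

open Finset ThmH Skew Shadow Profile

variable {α : Type} [DecidableEq α]

/-- **THE EXCESS-BOUNDED BOTTOM-LEVEL CONJECTURE** (a `Prop`; NOT asserted): for every finite matroid on `n` elements of
rank `ρ` with `2(n − ρ) + 1 ≤ n` and every `D ⊆ E` with `#D + n ≤ 2ρ + 1` (excess `2ρ − n ≥ #D − 1`),
`ρ·U^D_{n−ρ} ≤ (n − ρ)·U^D_{n−ρ+1}`.  Without the excess bound the statement is false (`#D = 3` at excess `1`,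
`#D = 4` at excess `2`: the module docstring); for `#D ≤ 2` the bound is implied by `2(n − ρ) + 1 ≤ n`. -/
def UniCircLymBottomExcess (α : Type) [DecidableEq α] : Prop :=
  ∀ (M : Matroid α) [M.Finite] (D : Finset α), 2 * ((gr M).card - rk M (gr M)) + 1 ≤ (gr M).card →
    D.card + (gr M).card ≤ 2 * rk M (gr M) + 1 →
    rk M (gr M) * (uniIndepSetsCirc M D ((gr M).card - rk M (gr M))).card ≤
      ((gr M).card - rk M (gr M)) * (uniIndepSetsCirc M D ((gr M).card - rk M (gr M) + 1)).card

/-- The (refuted) unrestricted statement implies the excess-bounded one (dependency graph only). -/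
theorem uniCircLymBottomExcess_of_uniCircLymBottom (h : UniCircLymBottom α) : UniCircLymBottomExcess α := by
  intro M _ D hk _
  exact h M D hk

/-- For circuits of size `≤ 2` the excess bound follows from `2(n − ρ) + 1 ≤ n`: the excess-bounded conjecture gives
the old inequality at every loop and parallel pair. -/
theorem uniCircLymBottom_small_of_excess (h : UniCircLymBottomExcess α) (M : Matroid α) [M.Finite]
    (D : Finset α) (hD : D.card ≤ 2) (hk : 2 * ((gr M).card - rk M (gr M)) + 1 ≤ (gr M).card) :
    rk M (gr M) * (uniIndepSetsCirc M D ((gr M).card - rk M (gr M))).card ≤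
      ((gr M).card - rk M (gr M)) * (uniIndepSetsCirc M D ((gr M).card - rk M (gr M) + 1)).card := by
  have hle : rk M (gr M) ≤ (gr M).card := rk_le_card' (gr M)
  exact h M D hk (by omega)

/-- **WHAT SURVIVES OF THE BRIDGE TO `(c)`**: on `#E = ρ + q + 1`, `q + 2 ≤ ρ`, the excess-bounded conjecture gives
`ρ·Σ_D U^D_{q+1} ≤ (q + 1)·Σ_D U^D_{q+2}` with both sums over the circuits of size `≤ ρ − q`. -/
theorem uniLym_c_small_of_uniCircLymBottomExcess (h : UniCircLymBottomExcess α) (M : Matroid α) [M.Finite]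
    {q : ℕ} (hn : (gr M).card = rk M (gr M) + q + 1) (hq : q + 2 ≤ rk M (gr M)) :
    rk M (gr M) * ∑ D ∈ (gr M).powerset.filter (fun D => D.card + q ≤ rk M (gr M)),
        (uniIndepSetsCirc M D (q + 1)).card ≤
      (q + 1) * ∑ D ∈ (gr M).powerset.filter (fun D => D.card + q ≤ rk M (gr M)),
        (uniIndepSetsCirc M D (q + 2)).card := by
  rw [mul_sum, mul_sum]
  apply sum_le_sum
  intro D hD
  rw [mem_filter] at hD
  have h1 := h M D (by omega) (by omega)
  have e : (gr M).card - rk M (gr M) = q + 1 := by omega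
  rw [e] at h1
  exact h1

end PercRepro.Cogirth
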